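import Summits.QuantumFields.BalabanUV.Beta.GAN24.DerivativeRateTransferLoewnerKKT

/-!
# `BalabanUV.Beta.GAN24.DerivativeRateTransferLoewnerKKTCoercive` — binder row G-an2-4 ∕ (CONV-C), route R6 «VALUES, NOT DERIVATIVES», PART 102:
# THE BORDERED MATRIX IS NONSINGULAR FROM COERCIVITY ON `ker Q` AND ONE REFERENCE FIELD PER SOURCE — the structural hypothesis `hk : IsUnit (kkt H Q).det` of
# every END of the route, from the same two letters PART 95 consumes (PART 93's `γ` on the block lattice, PART 97's transported block indicator)
# (unit b2b-balaban-gan24-p3, gen 48; v1)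

NOT IN PRINT; OUR PROOF (for the ROUTE; [folklore] linear algebra — the kernel of `[[H, Qᵀ],[Q, 0]]` is trivial: `Hu + Qᵀλ = 0`, `Qu = 0` ⟹ `⟨u,Hu⟩ = −⟨Qu,λ⟩ = 0` ⟹
`u = 0` by coercivity ⟹ `Qᵀλ = 0` ⟹ `λ_a = ⟨Qr_a, λ⟩ = ⟨r_a, Qᵀλ⟩ = 0`; Mathlib `Matrix.mulVec_injective_iff_isUnit`).  HONEST FRAMING (cell contract, verbatim):
«discharging `BetaPertH` makes Bałaban's UV stability UNCONDITIONAL — a real constructive-QFT result; it is NOT the continuum limit and NOT the Clay problem.»  HONEST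
DEPENDENCY (verbatim): «continuum YM on T⁴ ⇐ BetaPertH ∧ nine spine estimates (0/9 proved); BetaPertH ⇐ (D1) ∧ (D4) ∧ CAP+tail; G-an2-4 gates asym, D1 and NE2/3/4.»

WHY THIS FILE.  Every END of the route (PARTs 18 ∕ 20 ∕ 88 ∕ 94–101) quantifies over `hk : ∀ j, IsUnit (kkt (H j) (Qc j)).det` — an1's bordered matrix
`[[H, Qᵀ],[Q, 0]]` nonsingular, i.e. «`Q` onto and `H` non-degenerate on `ker Q`» (`CompositionSingular`, docstring of `effForm`).  The tree's criteria for it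
are algebraic (`isUnit_kkt_det_of_reg`: Bałaban's regularised form `H + QᵀAQ` and `QK⁻¹Qᵀ` invertible; `isUnit_kkt_det_of_kernelBasis`).  On the route's
side the natural data are the two LETTERS already on the ledger: COERCIVITY `γ|z|² ≤ ⟨z,Hz⟩` on `ker Q` (PART 92's `hcoer`; PART 93 `coercive_lattice` on
the block lattice) and a family of REFERENCE FIELDS `Q r_a = e_a` (a right inverse of `Q`; PART 97 `mulVec_Q_blockRef` on the block lattice).  This file
derives `hk` from exactly these, so that in PART 96's ledger the structural item «nonsingular bordered matrices» is no longer independent of (v).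

WHAT THIS FILE PROVES (0 sorry, 0 `def`, nothing cited): `kkt_mulVec_eq` (the bordered matrix at a vector), `eq_zero_of_coercive_of_ker`,
**`kkt_mulVec_injective_of_coercive`**, **`isUnit_kkt_det_of_coercive`** (`0 < γ`, `∀ z, Qz = 0 → γ|z|² ≤ ⟨z,Hz⟩`, `∀ a, Q r_a = e_a` ⟹
`IsUnit (kkt H Q).det`), the tower form `isUnit_kkt_det_tower_of_coercive`, and `effForm_diag_le_of_reference` (`Q r = e_a` ⟹ `𝒮(a,a) ≤ ⟨r,Hr⟩` — the size
letter `B` of PART 95's one-level `hN` is bounded by the reference energy `E`, so at ONE step `N` needs no hypothesis on `𝒮`).  WHAT IT DOES NOT DO: positivity of `H` off `ker Q` (not needed); Bałaban's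
`Δ_a > 0`.  SUPPLIER work on route C-R6° (rank 2, REDUCTION); no consumer of record; NEVER «G-an2-4 closed»; NOT (CONV-C), NOT D1, NOT `BetaPertH`, NOT
continuum, NOT Clay.  Records: `HOME/b2b-balaban-gan24-p3/gen48/R6-LEDGER-NOTE.md`, `…/gen48/README.md`.
-/

noncomputable section

open Set Matrix Finset

namespace Summit.QuantumFields.BalabanUV.Beta.GAN24.DerivativeRateTransferLoewnerKKTCoercive

open Literature.MathematicalPhysics.QuantumFieldTheory.Balaban1983to89.Beta.Composition (kkt)
open Literature.MathematicalPhysics.QuantumFieldTheory.Balaban1983to89.Beta.CompositionSingular (kkt_eq_fromBlocks)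
open Literature.MathematicalPhysics.QuantumFieldTheory.Balaban1983to89.Beta.CompositionSingular (effForm)
open Summit.QuantumFields.BalabanUV.Beta.GAN24.DerivativeRateTransferLoewnerKKT (mulVec_dotProduct_eq dotProduct_effForm_le_trial
  single_dotProduct_mulVec_single)

section OneLevel

variable {c ν : Type*} [Fintype c] [Fintype ν] [DecidableEq c] [DecidableEq ν]
variable {H : Matrix ν ν ℝ} {Q : Matrix c ν ℝ}

omit [DecidableEq c] [DecidableEq ν] in
/-- the bordered matrix at a vector: `kkt H Q (u ⊕ λ) = (Hu + Qᵀλ) ⊕ (Qu)`. [folklore] -/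
theorem kkt_mulVec_eq (w : ν ⊕ c → ℝ) :
    kkt H Q *ᵥ w = Sum.elim (H *ᵥ (w ∘ Sum.inl) + Qᵀ *ᵥ (w ∘ Sum.inr)) (Q *ᵥ (w ∘ Sum.inl)) := by
  rw [kkt_eq_fromBlocks, fromBlocks_mulVec, zero_mulVec, add_zero]

omit [Fintype c] [DecidableEq c] [DecidableEq ν] in
/-- coercivity on `ker Q` kills a fluctuation of zero energy: `Qz = 0`, `⟨z,Hz⟩ ≤ 0` ⟹ `z = 0`. [folklore] -/
theorem eq_zero_of_coercive_of_ker {γ : ℝ} (hγ : 0 < γ) (hcoer : ∀ z : ν → ℝ, Q *ᵥ z = 0 → γ * (z ⬝ᵥ z) ≤ z ⬝ᵥ (H *ᵥ z))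
    {z : ν → ℝ} (hz : Q *ᵥ z = 0) (hE : z ⬝ᵥ (H *ᵥ z) ≤ 0) : z = 0 := by
  have h0 : 0 ≤ z ⬝ᵥ z := by rw [dotProduct]; exact Finset.sum_nonneg fun i _ => mul_self_nonneg _
  have h1 : γ * (z ⬝ᵥ z) ≤ 0 := (hcoer z hz).trans hE
  have h2 : z ⬝ᵥ z = 0 := le_antisymm (by nlinarith) h0
  exact dotProduct_self_eq_zero.mp h2

omit [DecidableEq ν] in
/-- **`kkt_mulVec_injective_of_coercive` — THE BORDERED MATRIX HAS TRIVIAL KERNEL** [our proof]: coercivity `γ|z|² ≤ ⟨z,Hz⟩` on `ker Q` (`γ > 0`) and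
reference fields `Q r_a = e_a` for every source `a` ⟹ `kkt H Q` is injective. -/
theorem kkt_mulVec_injective_of_coercive {γ : ℝ} (hγ : 0 < γ) (hcoer : ∀ z : ν → ℝ, Q *ᵥ z = 0 → γ * (z ⬝ᵥ z) ≤ z ⬝ᵥ (H *ᵥ z))
    (r : c → ν → ℝ) (hr : ∀ a, Q *ᵥ r a = Pi.single a 1) : Function.Injective (kkt H Q).mulVec := by
  -- it suffices to show the kernel is trivial
  suffices hker : ∀ w : ν ⊕ c → ℝ, kkt H Q *ᵥ w = 0 → w = 0 by
    intro w₁ w₂ h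
    have h0 : kkt H Q *ᵥ (w₁ - w₂) = 0 := by rw [mulVec_sub, h, sub_self]
    exact sub_eq_zero.mp (hker _ h0)
  intro w hw
  rw [kkt_mulVec_eq] at hw
  set u : ν → ℝ := w ∘ Sum.inl with hu
  set lam : c → ℝ := w ∘ Sum.inr with hlam
  have h1 : H *ᵥ u + Qᵀ *ᵥ lam = 0 := by
    have := congrArg (fun f => f ∘ Sum.inl) hw
    simpa only [Sum.elim_comp_inl, Pi.zero_comp] using this
  have h2 : Q *ᵥ u = 0 := by
    have := congrArg (fun f => f ∘ Sum.inr) hw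
    simpa only [Sum.elim_comp_inr, Pi.zero_comp] using this
  -- `⟨u,Hu⟩ = −⟨u,Qᵀλ⟩ = −⟨Qu,λ⟩ = 0`
  have hE : u ⬝ᵥ (H *ᵥ u) ≤ 0 := by
    have hHu : H *ᵥ u = -(Qᵀ *ᵥ lam) := eq_neg_of_add_eq_zero_left h1
    rw [hHu, dotProduct_neg, ← mulVec_dotProduct_eq, h2, zero_dotProduct, neg_zero]
  have hu0 : u = 0 := eq_zero_of_coercive_of_ker hγ hcoer h2 hE
  -- `Qᵀλ = 0`, hence `λ_a = ⟨Q r_a, λ⟩ = ⟨r_a, Qᵀλ⟩ = 0`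
  have hQl : Qᵀ *ᵥ lam = 0 := by rw [hu0, mulVec_zero, zero_add] at h1; exact h1
  have hl0 : lam = 0 := by
    funext a
    have : (Q *ᵥ r a) ⬝ᵥ lam = 0 := by rw [mulVec_dotProduct_eq, hQl, dotProduct_zero]
    rw [hr a, single_dotProduct, one_mul] at this
    exact this
  -- reassemble
  funext i
  cases i with
  | inl x => exact congrFun hu0 x
  | inr a => exact congrFun hl0 a

/-- **`isUnit_kkt_det_of_coercive` — THE STRUCTURAL HYPOTHESIS `hk` FROM THE LEDGER'S LETTERS** [our proof]: coercivity on `ker Q` (`γ > 0`) and a right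
inverse of `Q` given by reference fields (`Q r_a = e_a` for all `a`) ⟹ `IsUnit (kkt H Q).det`. -/
theorem isUnit_kkt_det_of_coercive {γ : ℝ} (hγ : 0 < γ) (hcoer : ∀ z : ν → ℝ, Q *ᵥ z = 0 → γ * (z ⬝ᵥ z) ≤ z ⬝ᵥ (H *ᵥ z))
    (r : c → ν → ℝ) (hr : ∀ a, Q *ᵥ r a = Pi.single a 1) : IsUnit (kkt H Q).det :=
  (Matrix.isUnit_iff_isUnit_det _).mp (Matrix.mulVec_injective_iff_isUnit.mp (kkt_mulVec_injective_of_coercive hγ hcoer r hr))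

/-- **`effForm_diag_le_of_reference` — THE DIAGONAL SIZE OF `𝒮` FROM THE SAME REFERENCE FIELD**: `H` PSD, bordered matrix nonsingular, `Q r = e_a` ⟹
`𝒮(a,a) ≤ ⟨r, Hr⟩` (PART 18's trial-field inequality at `e_a`).  So the letter `B` of PART 95's one-level `hN` is itself bounded by the reference energy `E`:
at ONE step the Gram letter needs no size hypothesis on `𝒮` at all. [folklore] -/
theorem effForm_diag_le_of_reference (hH : H.PosSemidef) (h : IsUnit (kkt H Q).det) {a : c} {r : ν → ℝ} (hr : Q *ᵥ r = Pi.single a 1) :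
    effForm H Q a a ≤ r ⬝ᵥ (H *ᵥ r) := by
  have h1 := dotProduct_effForm_le_trial hH h hr
  rwa [single_dotProduct_mulVec_single] at h1

end OneLevel

section Tower

variable {c : Type*} [Fintype c] [DecidableEq c]
variable {ι : ℕ → Type*} [∀ j, Fintype (ι j)] [∀ j, DecidableEq (ι j)]
variable {H : ∀ j, Matrix (ι j) (ι j) ℝ} {Qc : ∀ j, Matrix c (ι j) ℝ}

/-- **`isUnit_kkt_det_tower_of_coercive` — `hk` ALONG THE TOWER** [our proof]: level letters `γ_j > 0` with coercivity on `ker Qc_j` and reference fields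
`Qc_j r_{j,a} = e_a` ⟹ `∀ j, IsUnit (kkt (H j) (Qc j)).det` — PART 96's structural item from its own (v). -/
theorem isUnit_kkt_det_tower_of_coercive {γ : ℕ → ℝ} (hγ : ∀ j, 0 < γ j)
    (hcoer : ∀ j (z : ι j → ℝ), Qc j *ᵥ z = 0 → γ j * (z ⬝ᵥ z) ≤ z ⬝ᵥ (H j *ᵥ z))
    (r : ∀ j, c → ι j → ℝ) (hr : ∀ j a, Qc j *ᵥ r j a = Pi.single a 1) : ∀ j, IsUnit (kkt (H j) (Qc j)).det := fun j =>
  isUnit_kkt_det_of_coercive (hγ j) (hcoer j) (r j) (hr j)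

end Tower

end Summit.QuantumFields.BalabanUV.Beta.GAN24.DerivativeRateTransferLoewnerKKTCoercive

end
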